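import Mathlib
import Summits.Ventures.PercRepro2.OneTypedEdge
import Summits.Ventures.PercRepro2.TypedUntouched

/-!
# A root-to-root path of two type-2 edges kills every typed base (blind cell PercRepro2,
night-3 g13, 2026-08-27; `proofs/NIGHT3-CERT.md` §22.5)

If two typed edges `e = {a₁, v}`, `f = {a₂, v}` (any vertex `v`) both have type `2` — each is open
in exactly two of the three copies — then in every typed triple some copy carries both, hence joins
the two roots, so `Q` fails in that copy and the kernel `K₃` vanishes (`KB_eq_zero_of_q'`): the
typed base is `0` on every graph, marking, pinning and typing of the other edges
(`typedCount_eq_zero_of_root_path_two`).  The type-level twin of the root-pair rule (f) of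
`TypedClosed.lean`; on the ∣F∣ = 9 domain of record it is the zero set of 5,347 positive instances
(128 type vectors each: a common neighbour of the roots, unmarked, `o` or `b`).
-/

namespace Summit.Ventures.PercRepro2

open UnionCluster

namespace CovForm

namespace RootPath

open OneTyped Untouched

section Main

open Classical

variable {V : Type*} {E : Type*} [Fintype E] [DecidableEq E] {R : Type*} [Field R]
variable (ends : E → Sym2 V) (o a₁ a₂ a₃ b : V)

omit [Fintype E] [DecidableEq E] in
/-- Two edges each open in two of the three copies are both open in some copy. -/
lemma exists_both_open {x y w : Config E} {e f : E}
    (he : (x e).toNat + (y e).toNat + (w e).toNat = 2)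
    (hf : (x f).toNat + (y f).toNat + (w f).toNat = 2) :
    (x e = true ∧ x f = true) ∨ (y e = true ∧ y f = true) ∨ (w e = true ∧ w f = true) := by
  cases hxe : x e <;> cases hye : y e <;> cases hwe : w e <;> cases hxf : x f <;> cases hyf : y f <;>
    cases hwf : w f <;> simp_all

omit [Fintype E] [DecidableEq E] in
/-- `K₃` vanishes at a triple in which some copy carries both edges of a root-to-root path. -/
lemma K3_eq_zero_of_both_open {e f : E} {v : V} (he : ends e = s(a₁, v)) (hf : ends f = s(a₂, v))
    (x y w : Config E)
    (h : (x e = true ∧ x f = true) ∨ (y e = true ∧ y f = true) ∨ (w e = true ∧ w f = true)) :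
    (K3 ends o a₁ a₂ a₃ b x y w : R) = 0 := by
  have key : ∀ u : Config E, u e = true → u f = true → Conn ends u a₂ a₁ := fun u hue huf =>
    conn_trans (conn_of_openAdj ⟨f, huf, hf⟩) (conn_symm (conn_of_openAdj ⟨e, hue, he⟩))
  rw [K3_eq_KB]
  have hq : ∀ u : Config E, Conn ends u a₂ a₁ → (st ends o a₁ a₂ a₃ b u).q' = true := fun u hu => by
    unfold st St.q'
    exact decide_eq_true hu
  rcases h with ⟨h1, h2⟩ | ⟨h1, h2⟩ | ⟨h1, h2⟩
  · rw [KB_eq_zero_of_q' _ _ _ (Or.inl (hq x (key x h1 h2)))]; simp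
  · rw [KB_eq_zero_of_q' _ _ _ (Or.inr (Or.inl (hq y (key y h1 h2))))]; simp
  · rw [KB_eq_zero_of_q' _ _ _ (Or.inr (Or.inr (hq w (key w h1 h2))))]; simp

/-- **A root-to-root path of two type-2 edges kills every typed base.** -/
theorem typedCount_eq_zero_of_root_path_two {e f : E} {v : V} (he : ends e = s(a₁, v))
    (hf : ends f = s(a₂, v)) (F : Finset E) (heF : e ∈ F) (hfF : f ∈ F) (z : Config E)
    (τ : E → ℕ) (hτe : τ e = 2) (hτf : τ f = 2) :
    typedCount F z τ (K3 ends o a₁ a₂ a₃ b : Config E → Config E → Config E → R) = 0 := by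
  rw [← typedCount_zero_kernel F z τ]
  refine typedCount_congr_on_support F z τ fun x y w _ hτ' => ?_
  have h2e := hτ' e heF
  have h2f := hτ' f hfF
  rw [hτe] at h2e
  rw [hτf] at h2f
  exact K3_eq_zero_of_both_open ends o a₁ a₂ a₃ b he hf x y w (exists_both_open h2e h2f)

end Main

end RootPath

end CovForm

end Summit.Ventures.PercRepro2
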